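import Mathlib
import Summits.NavierStokesRegularity.NavierStokesRegularity.Theorems.L3TimeExponentPincerRingDatumBounds
import Summits.NavierStokesRegularity.NavierStokesRegularity.Theorems.L3TimeExponentPincerRingDatumEnergyFloor
import Summits.NavierStokesRegularity.NavierStokesRegularity.Theorems.L3TimeExponentPincerRingDatumDecayIntegral
import HarnessLib.Audit
import HarnessLib

/-!
# L3TimeExponentPincer — ring datum calculus XVII: the energy of the glued-dipole datum at core
# scale `t⁴`

Support kernel for the crux `L3CascadeJaw` (item stmt-NavierStokesRegularity-19499); sequel of
`…RingDatumBounds` (same datum `u₀ = curl (F(|x|²) J)`, `F = ∫_{32}^{s} τ^{-5/2} G`,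
`G(s) = −κ (φ(s/t⁴ − 1) − φ(s/16 − 1))`).  The two energy hypotheses of
`lpPersistence_of_ringData` in closed form:

* `ringDatum_energy_le` — `∫⁻ ‖u₀‖ₑ² ≤ ofReal ((6656/9) κ²/t⁶) · I₆`, `I₆ = ∫⁻ (1 + ‖y‖)^{-6} dy`
  (`norm_ringField_sq_le_max` + `lintegral_inv_max_cube_le`; the four profile bounds from
  `…RingDatumPotential`);
* `ringDatum_energy_ge` — `ofReal (κ² V₁/(144000 t⁶)) ≤ ∫⁻ ‖u₀‖ₑ²` (the polar test ball of
  `…RingDatumPolarBall` inside the dipole zone `2t⁴ ≤ |x|² ≤ 4t⁴`, `norm_ringField_sq_ge_on_polarBall`).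

So with `κ = c_E t³` the energy is squeezed between two constants.  WHAT THIS IS NOT: not NS
regularity or blow-up; explicit-datum bookkeeping for a support lemma of a DRAFT route; no crux claim.
-/

namespace Summit.NavierStokesRegularity.NavierStokesRegularity.Theorems.L3TimeExponentPincerRingDatumEnergy

open Real Set Metric MeasureTheory Literature.Analysis.FluidPDE
open Summit.NavierStokesRegularity.NavierStokesRegularity.Theorems.L3TimeExponentPincerRingDatumBounds
open Summit.NavierStokesRegularity.NavierStokesRegularity.Theorems.L3TimeExponentPincerRingDatumShape
open Summit.NavierStokesRegularity.NavierStokesRegularity.Theorems.L3TimeExponentPincerRingDatumPotential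
open Summit.NavierStokesRegularity.NavierStokesRegularity.Theorems.L3TimeExponentPincerRingDatumProfile
open Summit.NavierStokesRegularity.NavierStokesRegularity.Theorems.L3TimeExponentPincerRingDatumMeasure
open Summit.NavierStokesRegularity.NavierStokesRegularity.Theorems.L3TimeExponentPincerRingDatumSpeedBound
open Summit.NavierStokesRegularity.NavierStokesRegularity.Theorems.L3TimeExponentPincerRingDatumDecayIntegral
open Summit.NavierStokesRegularity.NavierStokesRegularity.Theorems.L3TimeExponentPincerRingDatumEnergyFloor
open scoped ENNReal ContDiff Topology

variable {G F : ℝ → ℝ} {κ t : ℝ}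

/-- **Energy upper bound**: `∫⁻ ‖u₀‖ₑ² ≤ ofReal ((6656/9) κ² / t⁶) · I₆`,
`I₆ = ∫⁻ (1 + ‖y‖)^{-6} dy`. -/
theorem ringDatum_energy_le
    (hG : G = fun s => -κ * (Real.smoothTransition (s / t ^ 4 - 1) - Real.smoothTransition (s / 16 - 1)))
    (hF : F = fun s => ∫ τ in (32 : ℝ)..s, τ ^ (-(5 / 2 : ℝ)) * G τ) (ht : 0 < t) (ht1 : t ≤ 1)
    (hκ : 0 ≤ κ) :
    ∫⁻ x, ‖curl (fun y : EuclideanSpace ℝ (Fin 3) => F (‖y‖ ^ 2) • rotGen y) x‖ₑ ^ 2 ≤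
      ENNReal.ofReal (6656 / 9 * κ ^ 2 / t ^ 6) *
        ∫⁻ y : EuclideanSpace ℝ (Fin 3), ENNReal.ofReal ((1 + ‖y‖) ^ (-(6 : ℝ))) := by
  obtain ⟨ht4, hab, -⟩ := core_scale_bounds ht ht1
  obtain ⟨hGs, hGa, hGR, hFs, -, -⟩ := potential_facts hG hF ht ht1
  have hK : ∀ τ, |G τ| ≤ κ := fun τ => abs_shape_le hG hκ ht4 hab τ
  have hFd : Differentiable ℝ F := hFs.differentiable (by simp)
  -- the four profile bounds
  have h₁ : ∀ s, t ^ 4 ≤ s → |deriv F s| ≤ κ * s ^ (-(5 / 2 : ℝ)) := by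
    intro s hs; rw [hF]; exact abs_deriv_potential_le hGs ht4 hGa hK (ht4.le.trans hs)
  have h₁' : ∀ s, s < t ^ 4 → deriv F s = 0 := by
    intro s hs; rw [hF]; exact deriv_potential_eq_zero_of_le hGs ht4 hGa hs.le
  have h₀ : ∀ s, t ^ 4 ≤ s → |F s| ≤ (2 * κ / 3) * s ^ (-(3 / 2 : ℝ)) := by
    intro s hs; rw [hF]; exact abs_potential_le_of_ge ht4 hK hGR hs
  have h₀' : ∀ s, s < t ^ 4 → |F s| ≤ (2 * κ / 3) * (t ^ 4) ^ (-(3 / 2 : ℝ)) := by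
    intro s hs; rw [hF]; exact abs_potential_le_of_le hGs ht4 hGa hK hGR hs.le
  have hpt : ∀ x : EuclideanSpace ℝ (Fin 3),
      ‖curl (fun y : EuclideanSpace ℝ (Fin 3) => F (‖y‖ ^ 2) • rotGen y) x‖ₑ ^ 2 ≤
        ENNReal.ofReal (104 / 9 * κ ^ 2) * ENNReal.ofReal (((max (t ^ 4) (‖x‖ ^ 2)) ^ 3)⁻¹) := by
    intro x
    rw [← ofReal_norm, ← ENNReal.ofReal_pow (norm_nonneg _),
      ← ENNReal.ofReal_mul (by positivity)]
    exact ENNReal.ofReal_le_ofReal (norm_ringField_sq_le_max hFd ht4 h₁ h₁' h₀ h₀' x)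
  have hsa : Real.sqrt (t ^ 4) = t ^ 2 := by
    rw [show t ^ 4 = (t ^ 2) ^ 2 by ring, Real.sqrt_sq (by positivity)]
  calc ∫⁻ x, ‖curl (fun y : EuclideanSpace ℝ (Fin 3) => F (‖y‖ ^ 2) • rotGen y) x‖ₑ ^ 2
      ≤ ∫⁻ x : EuclideanSpace ℝ (Fin 3), ENNReal.ofReal (104 / 9 * κ ^ 2) *
          ENNReal.ofReal (((max (t ^ 4) (‖x‖ ^ 2)) ^ 3)⁻¹) := lintegral_mono hpt
    _ = ENNReal.ofReal (104 / 9 * κ ^ 2) *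
          ∫⁻ x : EuclideanSpace ℝ (Fin 3), ENNReal.ofReal (((max (t ^ 4) (‖x‖ ^ 2)) ^ 3)⁻¹) :=
        lintegral_const_mul' _ _ ENNReal.ofReal_ne_top
    _ ≤ ENNReal.ofReal (104 / 9 * κ ^ 2) * (ENNReal.ofReal (64 * Real.sqrt (t ^ 4) ^ 3 / (t ^ 4) ^ 3) *
          ∫⁻ y : EuclideanSpace ℝ (Fin 3), ENNReal.ofReal ((1 + ‖y‖) ^ (-(6 : ℝ)))) :=
        mul_le_mul' le_rfl (lintegral_inv_max_cube_le ht4)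
    _ = ENNReal.ofReal (6656 / 9 * κ ^ 2 / t ^ 6) *
          ∫⁻ y : EuclideanSpace ℝ (Fin 3), ENNReal.ofReal ((1 + ‖y‖) ^ (-(6 : ℝ))) := by
        rw [← mul_assoc, ← ENNReal.ofReal_mul (by positivity), hsa]
        congr 2
        field_simp
        ring

/-- **Energy floor**: `ofReal (κ² V₁ / (144000 t⁶)) ≤ ∫⁻ ‖u₀‖ₑ²` (polar test ball of radius `t²/10`
about `(17t²/10) e₂`, inside the dipole zone `2t⁴ ≤ |x|² ≤ 4t⁴`). -/
theorem ringDatum_energy_ge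
    (hG : G = fun s => -κ * (Real.smoothTransition (s / t ^ 4 - 1) - Real.smoothTransition (s / 16 - 1)))
    (hF : F = fun s => ∫ τ in (32 : ℝ)..s, τ ^ (-(5 / 2 : ℝ)) * G τ) (ht : 0 < t) (ht1 : t ≤ 1)
    (hκ : 0 ≤ κ) :
    ENNReal.ofReal (κ ^ 2 * (volume (ball (0 : EuclideanSpace ℝ (Fin 3)) 1)).toReal / (144000 * t ^ 6)) ≤
      ∫⁻ x, ‖curl (fun y : EuclideanSpace ℝ (Fin 3) => F (‖y‖ ^ 2) • rotGen y) x‖ₑ ^ 2 := by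
  obtain ⟨ht4, hab, -⟩ := core_scale_bounds ht ht1
  obtain ⟨hGs, -, -, hFs, hF', -⟩ := potential_facts hG hF ht ht1
  have hFd : Differentiable ℝ F := hFs.differentiable (by simp)
  have ht2 : 0 < t ^ 2 := by positivity
  have h41 : t ^ 4 ≤ 1 := pow_le_one₀ ht.le ht1
  -- the dipole zone `[2t⁴, 4t⁴] ⊆ [2a, b]`
  have hzone : ∀ s ∈ Icc (2 * (t ^ 2) ^ 2) (4 * (t ^ 2) ^ 2), s ∈ Icc (2 * t ^ 4) 16 := by
    intro s hs
    exact ⟨by nlinarith [hs.1], by nlinarith [hs.2]⟩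
  have hFder : ∀ s ∈ Icc (2 * (t ^ 2) ^ 2) (4 * (t ^ 2) ^ 2), deriv F s = -κ * s ^ (-(5 / 2 : ℝ)) := by
    intro s hs
    rw [hF']
    beta_reduce
    rw [shape_eq_neg_of_mem hG ht4 hab (hzone s hs)]
    ring
  have hFge : ∀ s ∈ Icc (2 * (t ^ 2) ^ 2) (4 * (t ^ 2) ^ 2),
      (2 * κ / 3) * (s ^ (-(3 / 2 : ℝ)) - (16 : ℝ) ^ (-(3 / 2 : ℝ))) ≤ F s := by
    intro s hs
    have hs' := hzone s hs
    have hs0 : 0 < s := by nlinarith [hs.1, pow_pos ht 4]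
    rw [hF]
    exact primitive_ge_of_plateau hGs.continuous (fun τ => shape_nonpos hG hκ ht4 hab τ) hs0
      (by nlinarith [hs'.2]) (by norm_num)
      (fun τ hτ => shape_eq_neg_of_mem hG ht4 hab ⟨hs'.1.trans hτ.1, hτ.2⟩)
  have hball : ∀ x ∈ ball (EuclideanSpace.single (2 : Fin 3) (17 * t ^ 2 / 10) : EuclideanSpace ℝ (Fin 3))
      (t ^ 2 / 10), ENNReal.ofReal (κ ^ 2 / (144 * (t ^ 2) ^ 6)) ≤
        ‖curl (fun y : EuclideanSpace ℝ (Fin 3) => F (‖y‖ ^ 2) • rotGen y) x‖ₑ ^ 2 := by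
    intro x hx
    rw [← ofReal_norm, ← ENNReal.ofReal_pow (norm_nonneg _)]
    exact ENNReal.ofReal_le_ofReal
      (norm_ringField_sq_ge_on_polarBall hFd hκ ht2 (by nlinarith) hFder hFge hx)
  have h := ofReal_le_lintegral_of_le_on_ball
    (f := fun x => ‖curl (fun y : EuclideanSpace ℝ (Fin 3) => F (‖y‖ ^ 2) • rotGen y) x‖ₑ ^ 2)
    (EuclideanSpace.single (2 : Fin 3) (17 * t ^ 2 / 10)) (e₀ := κ ^ 2 / (144 * (t ^ 2) ^ 6))
    (r₀ := t ^ 2 / 10) (by positivity) (by positivity) hball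
  refine le_trans (le_of_eq ?_) h
  congr 1
  field_simp
  ring

end Summit.NavierStokesRegularity.NavierStokesRegularity.Theorems.L3TimeExponentPincerRingDatumEnergy
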